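import Summits.AtomisticToContinuum.HydrodynamicLimit.Theses.RelayRaceLocality
import Summits.AtomisticToContinuum.HydrodynamicLimit.Theorems.RelayRaceLocalityLightConeInLawSketchLine
import Summits.AtomisticToContinuum.HydrodynamicLimit.Theorems.RelayRaceLocalityLightConeInLawStubTimeZero
import Summits.AtomisticToContinuum.HydrodynamicLimit.Theorems.RelayRaceLocalityLightConeInLawStubProfileIdOne
import Summits.AtomisticToContinuum.HydrodynamicLimit.Theorems.RelayRaceLocalityLightConeInLawStubProfileId
import Summits.AtomisticToContinuum.HydrodynamicLimit.Theorems.RelayRaceLocalityLightConeInLawNecessary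
import Summits.AtomisticToContinuum.HydrodynamicLimit.Theorems.RelayRaceLocalityLightConeInLawCSRLine
import Summits.AtomisticToContinuum.HydrodynamicLimit.Theorems.RelayRaceLocalityLightConeInLawCSRCountCentre
import Summits.AtomisticToContinuum.HydrodynamicLimit.Theorems.RelayRaceLocalityLightConeInLawCSRChargedAtoms
import Summits.AtomisticToContinuum.HydrodynamicLimit.Theorems.RelayRaceLocalityLightConeInLawCSRActivityGauge
import Literature.MathematicalPhysics.KineticTheory.HardSphereEulerProofs
import Literature.Analysis.FluidPDE.HardSphereRegularGeometry

/-!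
# Line `count-sufficiency-reduction` for the crux `LightConeInLaw` (stmt-AtomisticToContinuum-12500)

LEAD c5 RESHAPE (prover-line-stmt-AtomisticToContinuum-12500-c5-0, 2026-08-17): vocabulary landed as the tree module
`Theorems/RelayRaceLocalityLightConeInLawCSRLine.lean` (p137401; imported, local copies deleted); STUB 1
`stub_countWindows` split into the registered statics stubs `stub_countCentre` (1a: count LLN with the common
centre `∫_{B'} ρ₁`) and `stub_chargedAtoms` (1b: every count atom near the centre is charged by gas 1), with
`Holds.stub_countWindows_of` now PURE LOGIC from 1a + 1b. WAVE 1 (c5): 1a, 1b and STUB 2 LANDED (p138831, p140050, p138234)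
and are discharged inside `LightConeInLaw_of`, whose hypotheses are now exactly the three OPEN stubs. Registered open stubs after wave 1:
`stub_exteriorScreening`, `stub_countInsensitivity`, `stub_particleNumberContinuity` (closed: `stub_countCentre`, `stub_chargedAtoms`,
`stub_activityGauge`).

Route `RelayRaceLocality` (sub-problem `HydrodynamicLimit`), crux rank 2: the TWO-COPY LIGHT CONE IN LAW
for the hard-sphere gas at fixed reduced density (verbatim statement in the route file). Crux-plan
skeleton for the idea `Ideas/count-sufficiency-reduction.md` (ideator 1, r1; triage r1-1, r1-2, r1-3: pass),
planner `planner-cruxplan-stmt-AtomisticToContinuum-12500-count-sufficiency-re-0`, 2026-08-16.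

## The line in one paragraph

CONDITION, DON'T COUPLE. The refuted step of the route's own plan for this crux was an exact
interior coupling of two canonical laws (refuter 19843: the ball-count laws are TV-far). The card's
lever: the ball count `K = #{i : xᵢ(0) ∈ B'}` (`B' = B(x₀, R')`) is, together with the exterior
configuration, a SUFFICIENT STATISTIC of a canonical hard-core law with product one-body weights —
given `(K, exterior)` the interior law is one canonical kernel, the SAME for both gases once their
activities are gauge-equivalent on the ball (`a₁ = λ a₂`, STUB 2) and `u₁ = u₂`, `θ₁ = θ₂` there
(landed `stub_profileIdOne/stub_profileId` + agreement clause). So nothing is matched: both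
expectations are mixtures, over the count, of CONDITIONAL expectations, and the crux splits —
kernel-checked below through the abstract `mixture_bound` — into
* STUB 3 `stub_exteriorScreening` (XL, hardest): at EQUAL counts the two conditional expectations
  merge — exterior differences do not signal into `B(x₀, R' − c t)` by time `t` (two-run relay-race
  screening with identical interiors; the route's M1 + M2 in native Lieb–Robinson form, no interior
  seeds);
* STUB 4 `stub_countInsensitivity` (XL): for ONE gas, conditioning on nearby counts gives nearby
  time-`t` statistics (the card's residual S2: first moment, one scalar direction, no cone);
* STUB 1 `stub_countWindows` (M/L, statics): both counts concentrate in the same `δ(N+1)`-window and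
  gas 1 charges every count atom of the window (the exterior is a RESERVOIR absorbing the
  particle-number slack `n₂ N − (N+1)·(σ₂/σ₁)³ = o(N)` of the crux);
* STUB 2 `stub_activityGauge` (L, statics): reduced-density agreement on the ball forces `a₁ = λ a₂`
  there (local density approximation + injectivity of the low-density equation of state);
* STUB 5 `stub_particleNumberContinuity` (XL, NECESSARY — verbatim the conclusion of the tree's
  `Necessary.particleNumberContinuity_of_lightConeInLaw`): used ONLY when the agreement ball covers
  the torus, where no reservoir exists (`K ≡ N + 1`, STUB 4 is vacuous) and the crux literally IS
  particle-number continuity (`σ₁ = σ₂` is forced by the unit masses of the LLN limits).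
New relative to the dead line `Sketch` (same card; its one open stub was the crux itself): the
conditioning structure is now TYPED (`ballCount`, `CountLLN`, Mathlib's `ProbabilityTheory.cond`)
and the bookkeeping Why-5(c) of the card is a THEOREM (`mixture_bound`), so the difficulty is cut
into two named, separately attackable dynamic statements (screening at equal counts / one-gas
count-insensitivity) plus statics, instead of one stub equivalent to the crux.

## Composition (kernel-checked, sorry-free outside `Holds.stub_*`)

`LightConeInLaw_of : stub_exteriorScreening → stub_countInsensitivity → stub_particleNumberContinuity →
RelayRaceLocality.LightConeInLaw` (c5: the three statics stubs `stub_countCentre`, `stub_chargedAtoms`, `stub_activityGauge`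
are CLOSED by landed tree theorems and discharged inside the proof).
`η₀ := min` of the stubs' thresholds, `c := c_screening(M) + 1`, `σ₀ := min` of the stubs' `σ₀`.
Cases: `t = 0` — the landed `TimeZero.stub_timeZero` (p99261); `0 < t`, `R − c t ≤ 0` — `χ ≡ 0`;
`0 < t`, `0 < R − c t`, LOCAL regime (`B(x₀, R − t/2)` misses a point): with `R' := R − t/2` one has
`0 < R' < R` and `supp χ ⊂ B(x₀, R' − c_screening t)`; STUB 1 gives `m`, the count LLNs and `δ₀`;
STUB 3 (fed the identifications and the gauge `λ` of STUB 2) gives `δ_s(ε/8)`, STUB 4 gives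
`δ_c(ε/8)`; with `δ := min(δ_s, δ_c, δ₀)` and the window `W_N = {k ≤ N+1+n₂N : |k/(N+1) − m| ≤ δ}`
the mixture lemma bounds `|E₁ − E₂| ≤ 4·ε/8 + ε/8 + 2·ε/8 < ε` eventually. GLOBAL regime
(`∀ y, dist(y, x₀) ≤ R − t/2`): agreement holds on all of `𝕋³`; `∫ρᵢ(0) = 1`
(`integral_eq_one_of_llnAt`) forces `σ₁ = σ₂` (`sigma_eq_of_global_agreement`); the identifications
+ STUB 2 give `u₂ = u₁`, `θ₂ = θ₁`, `a₁ = λ a₂` everywhere, so the comparison law IS the canonical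
law of the conjunct's profile (`canonicalDensity_const_mul`), and STUB 5 concludes.

## Disproof used (`Cruxes/LightConeInLaw/Disproof.lean`, cdisprove cycle 1, read 2026-08-16T19:10Z)

§0 no kill. §1 (`∫ρᵢ(0) = 1`, `R ≥ 1 ⇒ σ₁ = σ₂`, "the crux collapses to PNC when the ball covers
the torus") is USED: it is exactly the composition's global regime (re-proved here as
`integral_eq_one_of_llnAt` / `sigma_eq_of_global_agreement`) and the reason STUB 5 exists.
§2/§2b (`…_false_without_thermalAgreement/velocityAgreement/support/tieOne/tieTwo`, landed
`Theorems/LightConeInLaw/Negative/HomogeneousWitness.lean`): every one of the five hypotheses is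
consumed — the ties and the thermal/velocity agreement feed the identifications
(`stub_profileIdOne/Id`, STUB 2) that make the interior kernels coincide inside STUB 3, and the
support clause is STUB 3's buffer `supp χ ⊂ B(x₀, R' − c t)`. §5
(`lightConeInLaw_false_without_positiveDiameter`, ideal-gas shear witness): honoured at STUB 3,
which is false for free streaming (an exterior shear streams into the ball) — its proof must use
collisions; STUBS 1, 2, 4, 5 are insensitive to the sign of the diameter and carry no locality. No
`-- Targets` section / `stub_*_false` theorem exists; no stub is an instance of a landed Negative
lemma (the homogeneous two-temperature witness violates STUB 3's thermal-agreement hypothesis and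
STUB 5's common-profile hypothesis).

## Vocabulary (local to the line; a lead landing a stub lands these first, as `SketchLine` was)

`ballCount x₀ r z` (number of positions of `z` in the open minimal-image ball), `CountLLN n P x₀ r m`
(`ballCount/(N+1) → m` in probability), `obsF Φ σ t χ F` (the crux observable), and the PROVED
support: `measurable_ballCount`, `measurable_obsF`, `mixture_bound` (+ its lemmas),
`integral_eq_one_of_llnAt`, `sigma_eq_of_global_agreement`, `canonicalDensity_const_mul`,
`localGibbsProfile_const_mul`.
-/

namespace Summit.AtomisticToContinuum.HydrodynamicLimit.Cruxes.LightConeInLaw.CountSufficiencyReduction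

open scoped BigOperators Topology Classical ENNReal ProbabilityTheory
open Filter Set MeasureTheory ProbabilityTheory
open Literature.MathematicalPhysics.KineticTheory Literature.Analysis.FluidPDE
open Summit.AtomisticToContinuum.HydrodynamicLimit.Theorems.LightConeInLawSketch
open Summit.AtomisticToContinuum.HydrodynamicLimit.Theorems.LightConeInLawCSR

noncomputable section

/-! ## Vocabulary of the line

LANDED (lead c5, p137401): `ballCount`, `CountLLN`, `obsF` and their lemmas, `integral_eq_one_of_llnAt`,
`canonicalDensity_const_mul` live in the tree module
`Summits/AtomisticToContinuum/HydrodynamicLimit/Theorems/RelayRaceLocalityLightConeInLawCSRLine.lean`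
(namespace `…Theorems.LightConeInLawCSR`, opened above); the local copies were deleted. -/

/-! ## The abstract mixture lemma (the bookkeeping of the card's Why-5(c), proved)

Two probability spaces, two integer statistics `K₁, K₂`, two observables `f₁, f₂` bounded by `1`,
a finite window `W` of counts. If (W) both statistics lie in `W` up to probability `α`, (P) every
atom of `W` is charged by the first law, (S) on every atom of `W` charged by the second law the two
CONDITIONAL expectations differ by at most `β`, and (C) the conditional expectations of the first
observable oscillate by at most `γ` over `W`, then the two expectations differ by at most
`4α + β + 2γ`. -/

section Mixture

variable {Ω : Type*} [MeasurableSpace Ω]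

/-- `|∫ f dμ| ≤ 1` for a probability measure and `|f| ≤ 1` (no integrability needed). -/
theorem abs_integral_le_one_of_abs_le_one (μ : Measure Ω) [IsProbabilityMeasure μ] {f : Ω → ℝ}
    (hf : ∀ ω, |f ω| ≤ 1) : |∫ ω, f ω ∂μ| ≤ 1 := by
  refine abs_integral_le_integral_abs.trans ?_
  calc ∫ ω, |f ω| ∂μ ≤ ∫ _ω, (1 : ℝ) ∂μ :=
        integral_mono_of_nonneg (ae_of_all _ fun ω => abs_nonneg _) (integrable_const _)
          (ae_of_all _ hf)
    _ = 1 := by simp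

/-- A set integral over an atom is the (real) mass of the atom times the conditional expectation;
true also for null atoms (both sides vanish). -/
theorem setIntegral_eq_measureReal_mul_integral_cond (μ : Measure Ω) [IsFiniteMeasure μ]
    (s : Set Ω) (f : Ω → ℝ) :
    ∫ ω in s, f ω ∂μ = μ.real s * ∫ ω, f ω ∂(μ[|s]) := by
  by_cases hs : μ s = 0
  · rw [setIntegral_measure_zero _ hs, measureReal_def, hs, ENNReal.toReal_zero, zero_mul]
  · rw [ProbabilityTheory.cond, integral_smul_measure, smul_eq_mul, ← mul_assoc, measureReal_def,
      ENNReal.toReal_inv, mul_inv_cancel₀ (ENNReal.toReal_ne_zero.2 ⟨hs, measure_ne_top μ s⟩),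
      one_mul]

/-- A set integral of a function bounded by `1` is bounded by the real mass of the set. -/
theorem abs_setIntegral_le_measureReal (μ : Measure Ω) [IsFiniteMeasure μ] (s : Set Ω)
    {f : Ω → ℝ} (hf : ∀ ω, |f ω| ≤ 1) : |∫ ω in s, f ω ∂μ| ≤ μ.real s := by
  have h := norm_setIntegral_le_of_norm_le_const (measure_lt_top μ s)
    (fun ω _ => show ‖f ω‖ ≤ 1 by rw [Real.norm_eq_abs]; exact hf ω)
  rw [Real.norm_eq_abs, one_mul] at h
  exact h

variable {Ω₁ Ω₂ : Type*} [MeasurableSpace Ω₁] [MeasurableSpace Ω₂]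

/-- Decomposition of an expectation along the atoms of an integer statistic inside a finite
window: `∫ f = ∑_{k ∈ W} μ.real{K = k} · E[f | K = k] + ∫_{K ∉ W} f`. -/
theorem integral_eq_sum_window_add (μ : Measure Ω₁) [IsFiniteMeasure μ] {K : Ω₁ → ℕ}
    (hK : Measurable K) {f : Ω₁ → ℝ} (hfi : Integrable f μ) (W : Finset ℕ) :
    ∫ ω, f ω ∂μ = (∑ k ∈ W, μ.real (K ⁻¹' {k}) * ∫ ω, f ω ∂(μ[|K ⁻¹' {k}])) +
      ∫ ω in {ω | K ω ∉ W}, f ω ∂μ := by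
  have hA : MeasurableSet (K ⁻¹' (↑W : Set ℕ)) := hK W.measurableSet
  have hsplit := integral_add_compl hA hfi
  have hcompl : (K ⁻¹' (↑W : Set ℕ))ᶜ = {ω | K ω ∉ W} := by
    ext ω; simp
  rw [hcompl] at hsplit
  rw [← hsplit]
  congr 1
  rw [← Set.biUnion_preimage_singleton, Finset.set_biUnion_coe,
    integral_biUnion_finset W (fun k _ => hK (measurableSet_singleton k))]
  · refine Finset.sum_congr rfl fun k _ => ?_
    exact setIntegral_eq_measureReal_mul_integral_cond μ _ f
  · intro k _ k' _ hkk'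
    exact (Set.disjoint_singleton.2 hkk').preimage K
  · exact fun k _ => hfi.integrableOn

/-- **The mixture lemma.** See the section docstring. -/
theorem mixture_bound (μ₁ : Measure Ω₁) (μ₂ : Measure Ω₂) [IsProbabilityMeasure μ₁]
    [IsProbabilityMeasure μ₂] {K₁ : Ω₁ → ℕ} {K₂ : Ω₂ → ℕ} (hK₁ : Measurable K₁)
    (hK₂ : Measurable K₂) {f₁ : Ω₁ → ℝ} {f₂ : Ω₂ → ℝ} (hf₁ : Measurable f₁) (hf₂ : Measurable f₂)
    (hb₁ : ∀ ω, |f₁ ω| ≤ 1) (hb₂ : ∀ ω, |f₂ ω| ≤ 1) (W : Finset ℕ) {α β γ : ℝ} (_hα : 0 ≤ α)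
    (hβ : 0 ≤ β) (hγ : 0 ≤ γ)
    (hW₁ : μ₁.real {ω | K₁ ω ∉ W} ≤ α) (hW₂ : μ₂.real {ω | K₂ ω ∉ W} ≤ α)
    (hpos : ∀ k ∈ W, μ₁ (K₁ ⁻¹' {k}) ≠ 0)
    (hS : ∀ k ∈ W, μ₂ (K₂ ⁻¹' {k}) ≠ 0 →
      |∫ ω, f₁ ω ∂(μ₁[|K₁ ⁻¹' {k}]) - ∫ ω, f₂ ω ∂(μ₂[|K₂ ⁻¹' {k}])| ≤ β)
    (hC : ∀ k ∈ W, ∀ k' ∈ W,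
      |∫ ω, f₁ ω ∂(μ₁[|K₁ ⁻¹' {k}]) - ∫ ω, f₁ ω ∂(μ₁[|K₁ ⁻¹' {k'}])| ≤ γ) :
    |∫ ω, f₁ ω ∂μ₁ - ∫ ω, f₂ ω ∂μ₂| ≤ 4 * α + β + 2 * γ := by
  -- notation
  set e₁ : ℕ → ℝ := fun k => ∫ ω, f₁ ω ∂(μ₁[|K₁ ⁻¹' {k}]) with he₁
  set e₂ : ℕ → ℝ := fun k => ∫ ω, f₂ ω ∂(μ₂[|K₂ ⁻¹' {k}]) with he₂
  set p₁ : ℕ → ℝ := fun k => μ₁.real (K₁ ⁻¹' {k}) with hp₁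
  set p₂ : ℕ → ℝ := fun k => μ₂.real (K₂ ⁻¹' {k}) with hp₂
  have hI₁ : |∫ ω, f₁ ω ∂μ₁| ≤ 1 := abs_integral_le_one_of_abs_le_one μ₁ hb₁
  have hI₂ : |∫ ω, f₂ ω ∂μ₂| ≤ 1 := abs_integral_le_one_of_abs_le_one μ₂ hb₂
  -- the empty window: `α ≥ 1` and the bound is trivial
  rcases W.eq_empty_or_nonempty with hW | ⟨k₀, hk₀⟩
  · subst hW
    have h1 : (1 : ℝ) ≤ α := by
      have : μ₁.real {ω | K₁ ω ∉ (∅ : Finset ℕ)} = 1 := by simp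
      linarith
    have h2 : |∫ ω, f₁ ω ∂μ₁ - ∫ ω, f₂ ω ∂μ₂| ≤ 2 := by
      have := abs_sub (∫ ω, f₁ ω ∂μ₁) (∫ ω, f₂ ω ∂μ₂)
      linarith
    nlinarith
  -- integrability
  have hfi₁ : Integrable f₁ μ₁ := Integrable.of_bound hf₁.aestronglyMeasurable 1
    (ae_of_all _ fun ω => by rw [Real.norm_eq_abs]; exact hb₁ ω)
  have hfi₂ : Integrable f₂ μ₂ := Integrable.of_bound hf₂.aestronglyMeasurable 1
    (ae_of_all _ fun ω => by rw [Real.norm_eq_abs]; exact hb₂ ω)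
  -- decompositions along the window
  have hdec₁ := integral_eq_sum_window_add μ₁ hK₁ hfi₁ W
  have hdec₂ := integral_eq_sum_window_add μ₂ hK₂ hfi₂ W
  -- tails
  have htail₁ : |∫ ω in {ω | K₁ ω ∉ W}, f₁ ω ∂μ₁| ≤ α :=
    (abs_setIntegral_le_measureReal μ₁ _ hb₁).trans hW₁
  have htail₂ : |∫ ω in {ω | K₂ ω ∉ W}, f₂ ω ∂μ₂| ≤ α :=
    (abs_setIntegral_le_measureReal μ₂ _ hb₂).trans hW₂
  -- masses of the window
  have hmass₁ : ∑ k ∈ W, p₁ k = μ₁.real (K₁ ⁻¹' (↑W : Set ℕ)) :=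
    sum_measureReal_preimage_singleton W (fun k _ => hK₁ (measurableSet_singleton k))
  have hmass₂ : ∑ k ∈ W, p₂ k = μ₂.real (K₂ ⁻¹' (↑W : Set ℕ)) :=
    sum_measureReal_preimage_singleton W (fun k _ => hK₂ (measurableSet_singleton k))
  have hcompl₁ : μ₁.real (K₁ ⁻¹' (↑W : Set ℕ)) = 1 - μ₁.real {ω | K₁ ω ∉ W} := by
    have h := measureReal_compl (μ := μ₁) (hK₁ W.measurableSet)
    have hc : (K₁ ⁻¹' (↑W : Set ℕ))ᶜ = {ω | K₁ ω ∉ W} := by ext ω; simp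
    rw [hc, probReal_univ] at h
    linarith
  have hcompl₂ : μ₂.real (K₂ ⁻¹' (↑W : Set ℕ)) = 1 - μ₂.real {ω | K₂ ω ∉ W} := by
    have h := measureReal_compl (μ := μ₂) (hK₂ W.measurableSet)
    have hc : (K₂ ⁻¹' (↑W : Set ℕ))ᶜ = {ω | K₂ ω ∉ W} := by ext ω; simp
    rw [hc, probReal_univ] at h
    linarith
  have hm₁lo : 1 - α ≤ ∑ k ∈ W, p₁ k := by rw [hmass₁, hcompl₁]; linarith
  have hm₁hi : ∑ k ∈ W, p₁ k ≤ 1 := by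
    rw [hmass₁, hcompl₁]; linarith [measureReal_nonneg (μ := μ₁) (s := {ω | K₁ ω ∉ W})]
  have hm₂lo : 1 - α ≤ ∑ k ∈ W, p₂ k := by rw [hmass₂, hcompl₂]; linarith
  have hm₂hi : ∑ k ∈ W, p₂ k ≤ 1 := by
    rw [hmass₂, hcompl₂]; linarith [measureReal_nonneg (μ := μ₂) (s := {ω | K₂ ω ∉ W})]
  have hp₁nn : ∀ k, 0 ≤ p₁ k := fun k => measureReal_nonneg
  have hp₂nn : ∀ k, 0 ≤ p₂ k := fun k => measureReal_nonneg
  -- the reference value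
  have he₁k₀ : |e₁ k₀| ≤ 1 := by
    haveI := cond_isProbabilityMeasure (μ := μ₁) (hpos k₀ hk₀)
    exact abs_integral_le_one_of_abs_le_one _ hb₁
  -- gas 1: the window sum is `e₁ k₀ · (mass) ± γ`
  have hsum₁ : |(∑ k ∈ W, p₁ k * e₁ k) - e₁ k₀ * ∑ k ∈ W, p₁ k| ≤ γ := by
    rw [Finset.mul_sum, ← Finset.sum_sub_distrib]
    refine (Finset.abs_sum_le_sum_abs _ _).trans ?_
    calc ∑ k ∈ W, |p₁ k * e₁ k - e₁ k₀ * p₁ k| = ∑ k ∈ W, p₁ k * |e₁ k - e₁ k₀| := by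
          refine Finset.sum_congr rfl fun k _ => ?_
          rw [show p₁ k * e₁ k - e₁ k₀ * p₁ k = p₁ k * (e₁ k - e₁ k₀) by ring, abs_mul,
            abs_of_nonneg (hp₁nn k)]
      _ ≤ ∑ k ∈ W, p₁ k * γ :=
          Finset.sum_le_sum fun k hk => mul_le_mul_of_nonneg_left (hC k hk k₀ hk₀) (hp₁nn k)
      _ = (∑ k ∈ W, p₁ k) * γ := by rw [Finset.sum_mul]
      _ ≤ 1 * γ := mul_le_mul_of_nonneg_right hm₁hi hγ
      _ = γ := one_mul γ
  -- gas 2: the window sum is `e₁ k₀ · (mass) ± (β + γ)`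
  have hsum₂ : |(∑ k ∈ W, p₂ k * e₂ k) - e₁ k₀ * ∑ k ∈ W, p₂ k| ≤ β + γ := by
    rw [Finset.mul_sum, ← Finset.sum_sub_distrib]
    refine (Finset.abs_sum_le_sum_abs _ _).trans ?_
    have hterm : ∀ k ∈ W, |p₂ k * e₂ k - e₁ k₀ * p₂ k| ≤ p₂ k * (β + γ) := by
      intro k hk
      rw [show p₂ k * e₂ k - e₁ k₀ * p₂ k = p₂ k * (e₂ k - e₁ k₀) by ring, abs_mul,
        abs_of_nonneg (hp₂nn k)]
      by_cases hz : μ₂ (K₂ ⁻¹' {k}) = 0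
      · have : p₂ k = 0 := by simp only [hp₂, measureReal_def, hz, ENNReal.toReal_zero]
        rw [this, zero_mul, zero_mul]
      · refine mul_le_mul_of_nonneg_left ?_ (hp₂nn k)
        have h1 := hS k hk hz
        have h2 := hC k hk k₀ hk₀
        calc |e₂ k - e₁ k₀| ≤ |e₂ k - e₁ k| + |e₁ k - e₁ k₀| := abs_sub_le _ _ _
          _ ≤ β + γ := by rw [abs_sub_comm]; exact add_le_add h1 h2
    calc ∑ k ∈ W, |p₂ k * e₂ k - e₁ k₀ * p₂ k| ≤ ∑ k ∈ W, p₂ k * (β + γ) :=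
          Finset.sum_le_sum hterm
      _ = (∑ k ∈ W, p₂ k) * (β + γ) := by rw [Finset.sum_mul]
      _ ≤ 1 * (β + γ) := mul_le_mul_of_nonneg_right hm₂hi (add_nonneg hβ hγ)
      _ = β + γ := one_mul _
  -- `e₁ k₀ · mass` is within `α` of `e₁ k₀`
  have href₁ : |e₁ k₀ * (∑ k ∈ W, p₁ k) - e₁ k₀| ≤ α := by
    rw [show e₁ k₀ * (∑ k ∈ W, p₁ k) - e₁ k₀ = e₁ k₀ * ((∑ k ∈ W, p₁ k) - 1) by ring, abs_mul]
    calc |e₁ k₀| * |(∑ k ∈ W, p₁ k) - 1| ≤ 1 * α := by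
          refine mul_le_mul he₁k₀ ?_ (abs_nonneg _) zero_le_one
          rw [abs_sub_comm, abs_of_nonneg (by linarith)]
          linarith
      _ = α := one_mul α
  have href₂ : |e₁ k₀ * (∑ k ∈ W, p₂ k) - e₁ k₀| ≤ α := by
    rw [show e₁ k₀ * (∑ k ∈ W, p₂ k) - e₁ k₀ = e₁ k₀ * ((∑ k ∈ W, p₂ k) - 1) by ring, abs_mul]
    calc |e₁ k₀| * |(∑ k ∈ W, p₂ k) - 1| ≤ 1 * α := by
          refine mul_le_mul he₁k₀ ?_ (abs_nonneg _) zero_le_one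
          rw [abs_sub_comm, abs_of_nonneg (by linarith)]
          linarith
      _ = α := one_mul α
  -- assemble
  have hE₁ : |∫ ω, f₁ ω ∂μ₁ - e₁ k₀| ≤ 2 * α + γ := by
    rw [hdec₁]
    have := abs_sub_le ((∑ k ∈ W, p₁ k * e₁ k) + ∫ ω in {ω | K₁ ω ∉ W}, f₁ ω ∂μ₁)
      ((e₁ k₀ * ∑ k ∈ W, p₁ k) + ∫ ω in {ω | K₁ ω ∉ W}, f₁ ω ∂μ₁) (e₁ k₀)
    have h3 : |(e₁ k₀ * ∑ k ∈ W, p₁ k) + ∫ ω in {ω | K₁ ω ∉ W}, f₁ ω ∂μ₁ - e₁ k₀| ≤ α + α := by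
      calc |(e₁ k₀ * ∑ k ∈ W, p₁ k) + ∫ ω in {ω | K₁ ω ∉ W}, f₁ ω ∂μ₁ - e₁ k₀|
            = |(e₁ k₀ * (∑ k ∈ W, p₁ k) - e₁ k₀) + ∫ ω in {ω | K₁ ω ∉ W}, f₁ ω ∂μ₁| := by
              ring_nf
        _ ≤ |e₁ k₀ * (∑ k ∈ W, p₁ k) - e₁ k₀| + |∫ ω in {ω | K₁ ω ∉ W}, f₁ ω ∂μ₁| :=
              abs_add_le _ _
        _ ≤ α + α := add_le_add href₁ htail₁
    have h4 : |(∑ k ∈ W, p₁ k * e₁ k) + ∫ ω in {ω | K₁ ω ∉ W}, f₁ ω ∂μ₁ -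
        ((e₁ k₀ * ∑ k ∈ W, p₁ k) + ∫ ω in {ω | K₁ ω ∉ W}, f₁ ω ∂μ₁)| ≤ γ := by
      have : (∑ k ∈ W, p₁ k * e₁ k) + ∫ ω in {ω | K₁ ω ∉ W}, f₁ ω ∂μ₁ -
          ((e₁ k₀ * ∑ k ∈ W, p₁ k) + ∫ ω in {ω | K₁ ω ∉ W}, f₁ ω ∂μ₁) =
          (∑ k ∈ W, p₁ k * e₁ k) - e₁ k₀ * ∑ k ∈ W, p₁ k := by ring
      rw [this]; exact hsum₁
    linarith
  have hE₂ : |∫ ω, f₂ ω ∂μ₂ - e₁ k₀| ≤ 2 * α + β + γ := by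
    rw [hdec₂]
    have := abs_sub_le ((∑ k ∈ W, p₂ k * e₂ k) + ∫ ω in {ω | K₂ ω ∉ W}, f₂ ω ∂μ₂)
      ((e₁ k₀ * ∑ k ∈ W, p₂ k) + ∫ ω in {ω | K₂ ω ∉ W}, f₂ ω ∂μ₂) (e₁ k₀)
    have h3 : |(e₁ k₀ * ∑ k ∈ W, p₂ k) + ∫ ω in {ω | K₂ ω ∉ W}, f₂ ω ∂μ₂ - e₁ k₀| ≤ α + α := by
      calc |(e₁ k₀ * ∑ k ∈ W, p₂ k) + ∫ ω in {ω | K₂ ω ∉ W}, f₂ ω ∂μ₂ - e₁ k₀|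
            = |(e₁ k₀ * (∑ k ∈ W, p₂ k) - e₁ k₀) + ∫ ω in {ω | K₂ ω ∉ W}, f₂ ω ∂μ₂| := by
              ring_nf
        _ ≤ |e₁ k₀ * (∑ k ∈ W, p₂ k) - e₁ k₀| + |∫ ω in {ω | K₂ ω ∉ W}, f₂ ω ∂μ₂| :=
              abs_add_le _ _
        _ ≤ α + α := add_le_add href₂ htail₂
    have h4 : |(∑ k ∈ W, p₂ k * e₂ k) + ∫ ω in {ω | K₂ ω ∉ W}, f₂ ω ∂μ₂ -
        ((e₁ k₀ * ∑ k ∈ W, p₂ k) + ∫ ω in {ω | K₂ ω ∉ W}, f₂ ω ∂μ₂)| ≤ β + γ := by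
      have : (∑ k ∈ W, p₂ k * e₂ k) + ∫ ω in {ω | K₂ ω ∉ W}, f₂ ω ∂μ₂ -
          ((e₁ k₀ * ∑ k ∈ W, p₂ k) + ∫ ω in {ω | K₂ ω ∉ W}, f₂ ω ∂μ₂) =
          (∑ k ∈ W, p₂ k * e₂ k) - e₁ k₀ * ∑ k ∈ W, p₂ k := by ring
      rw [this]; exact hsum₂
    linarith
  calc |∫ ω, f₁ ω ∂μ₁ - ∫ ω, f₂ ω ∂μ₂|
        ≤ |∫ ω, f₁ ω ∂μ₁ - e₁ k₀| + |e₁ k₀ - ∫ ω, f₂ ω ∂μ₂| := abs_sub_le _ _ _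
    _ ≤ (2 * α + γ) + (2 * α + β + γ) := by
        rw [abs_sub_comm (e₁ k₀)]; exact add_le_add hE₁ hE₂
    _ = 4 * α + β + 2 * γ := by ring

end Mixture

/-! ## Registered stubs (`Holds.stub_*`, bodies `sorry`) -/

namespace Holds

/-- STUB 1a — **COUNT CENTRE** (statics; size M/L; reshaped by lead c5 from the planner's STUB 1
`stub_countWindows`, part (a)). For the two gases of the crux at time `0` (laws of large numbers
`LLNAt … 0` towards continuous data `ρ₁, ρ₂` whose REDUCED densities agree on `B(x₀, R)`) and a ball
`B' = B(x₀, R')`, `0 < R' < R`: the ball counts of BOTH gases, normalised by `N + 1`, converge in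
probability to the SAME number `m := ∫_{B'} ρ₁` (gas 2 is normalised by `N + 1`, not by its own particle
number `n₂ N`: `n₂ N/(N+1) → (σ₂/σ₁)³` — from `n₂ N ε_N³ → σ₂³` and `(N+1) ε_N³ = σ₁³` — compensates
`ρ₂ = ρ₁ σ₁³/σ₂³` on the ball). Mechanism: sandwich `𝟙_{B'}` between continuous test functions
`χ₋ ≤ 𝟙_{B'} ≤ χ₊` (minimal-image distance is continuous, `Torus.continuous_euclidDist`), apply the
density part of `LLNAt` to `χ±`, and let the collar shrink: `∫ χ± ρᵢ → ∫_{B'} ρᵢ` because the sphere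
`{dist(·, x₀) = R'}` is Haar-null and `ρᵢ` is continuous (dominated convergence). Why it might fail: it
does not (elementary measure theory on `𝕋³`). -/
theorem stub_countCentre :
    ∀ (a₁ θ₁ a₂ θ₂ : T3 → ℝ) (u₁ u₂ : T3 → V3),
    ∀ (σ₁ σ₂ : ℝ), 0 < σ₁ → 0 < σ₂ →
    ∀ n₂ : ℕ → ℕ, Tendsto (fun N => (n₂ N : ℝ) * hsDiameter σ₁ N ^ 3) atTop (𝓝 (σ₂ ^ 3)) →
    ∀ (Φ₁ : (N : ℕ) → HardSphereFlow G3 (hsDiameter σ₁ N) (N + 1))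
      (Φ₂ : (N : ℕ) → HardSphereFlow G3 (hsDiameter σ₁ N) (n₂ N)),
    (∀ N, IsProbabilityMeasure (localGibbsLaw σ₁ a₁ u₁ θ₁ N (Φ₁ N))) →
    (∀ N, IsProbabilityMeasure (particleLaw (Φ₂ N)
      (canonicalDensity G3 (hsDiameter σ₁ N) (n₂ N) (localGibbsProfile a₂ u₂ θ₂)))) →
    ∀ (ρ₁ Θ₁ ρ₂ Θ₂ : T3 → ℝ) (U₁ U₂ : T3 → V3), Continuous ρ₁ → Continuous ρ₂ →
    LLNAt (fun N => N + 1) (fun N => localGibbsLaw σ₁ a₁ u₁ θ₁ N (Φ₁ N)) Φ₁ ρ₁ U₁ Θ₁ 0 →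
    LLNAt n₂ (fun N => particleLaw (Φ₂ N)
      (canonicalDensity G3 (hsDiameter σ₁ N) (n₂ N) (localGibbsProfile a₂ u₂ θ₂))) Φ₂
      ρ₂ U₂ Θ₂ 0 →
    ∀ (x₀ : T3) (R R' : ℝ), 0 < R' → R' < R →
      (∀ x, Torus.euclidDist x x₀ < R → ρ₁ x * σ₁ ^ 3 = ρ₂ x * σ₂ ^ 3) →
      CountLLN (fun N => N + 1) (fun N => localGibbsLaw σ₁ a₁ u₁ θ₁ N (Φ₁ N)) x₀ R'
        (∫ x in {x | Torus.euclidDist x x₀ < R'}, ρ₁ x) ∧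
      CountLLN n₂ (fun N => particleLaw (Φ₂ N)
        (canonicalDensity G3 (hsDiameter σ₁ N) (n₂ N) (localGibbsProfile a₂ u₂ θ₂))) x₀ R'
        (∫ x in {x | Torus.euclidDist x x₀ < R'}, ρ₁ x) :=
  -- CLOSED (lead c5 wave 1, p138831): the landed tree theorem, statement byte-identical.
  Summit.AtomisticToContinuum.HydrodynamicLimit.Theorems.LightConeInLawCSR.stub_countCentre

/-- STUB 1b — **CHARGED COUNT ATOMS** (statics; size L; reshaped by lead c5 from the planner's STUB 1
`stub_countWindows`, part (b)). For the conjunct's gas (`N + 1` spheres of diameter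
`ε_N = hsDiameter σ₁ N`, local Gibbs law a probability measure — so its canonical partition function is
positive and its density `Z⁻¹ 𝟙_D ∏ a₁(xᵢ) M_{u₁,θ₁}(vᵢ)` is positive on the whole hard-sphere domain),
a continuous positive unit-mass density profile `ρ₁` obeying the packing guard `ρ₁ σ₁³ < η₀`, and a ball
`B' = B(x₀, R')`, `0 < R'`, whose open exterior `{R' < dist(·, x₀)}` is nonempty (a RESERVOIR of
positive volume): there is `δ₀ > 0` such that for all large `N` EVERY count atom `{ballCount x₀ R' = k}`
with `|k/(N+1) − ∫_{B'} ρ₁| ≤ δ₀` has positive probability. Mechanism: cut `𝕋³` into the `K³` cells of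
the tree's chessboard geometry (`NearConstantShortTimeHL.torus_cells_partition/_separation`,
`Theorems/RelayRaceLocalityNearConstantShortTimeHLTorusCells.lean`) with `K = K_N` even and
`ε_N ≤ 1/K_N < 2 ε_N`-ish; points in distinct cells of ONE parity class are `> 1/K ≥ ε_N` apart, and
there are `K³/8 ≍ (N+1)/(8σ₁³)` such cells, a fraction `→ |B'|` of them inside `B'` and `→ |ext|` inside
the exterior (inner parallel sets exhaust an open set); the guard and unit mass give
`∫_{B'} ρ₁ ≤ η₀ |B'|/σ₁³`, `∫_{ext} ρ₁ ≤ η₀ |ext|/σ₁³`, so with `η₀ = 1/32` (say) and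
`δ₀ ≍ min(|B'|, |ext|)/σ₁³` there is room for `k` centres in parity cells inside `B'` and `N + 1 − k` in
parity cells inside the exterior; the product of those cells (positions) times velocity balls is a set of
positive Liouville measure inside `{ballCount = k} ∩ D_ε` on which the local Gibbs density is positive.
Why it might fail: only through a slip in the constants (it is elementary); `0 < R'` and the reservoir
clause are needed (for `B' = ∅` only `k = 0`, for `B' ⊇ 𝕋³` only `k = N + 1` is charged). -/
theorem stub_chargedAtoms :
    ∃ η₀ : ℝ, 0 < η₀ ∧
    ∀ (a₁ θ₁ : T3 → ℝ) (u₁ : T3 → V3), Continuous a₁ → Continuous θ₁ → Continuous u₁ →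
      (∀ x, 0 < a₁ x) → (∀ x, 0 < θ₁ x) →
    ∀ σ₁ : ℝ, 0 < σ₁ →
    ∀ Φ₁ : (N : ℕ) → HardSphereFlow G3 (hsDiameter σ₁ N) (N + 1),
    (∀ N, IsProbabilityMeasure (localGibbsLaw σ₁ a₁ u₁ θ₁ N (Φ₁ N))) →
    ∀ ρ₁ : T3 → ℝ, Continuous ρ₁ → (∀ x, 0 < ρ₁ x) → (∫ x, ρ₁ x) = 1 →
    ∀ (x₀ : T3) (R' : ℝ), 0 < R' → (∃ y, R' < Torus.euclidDist y x₀) →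
      (∀ x, ρ₁ x * σ₁ ^ 3 < η₀) →
    ∃ δ₀ : ℝ, 0 < δ₀ ∧ ∀ᶠ (N : ℕ) in atTop, ∀ k : ℕ,
      |(k : ℝ) / ((N : ℝ) + 1) - ∫ x in {x | Torus.euclidDist x x₀ < R'}, ρ₁ x| ≤ δ₀ →
        localGibbsLaw σ₁ a₁ u₁ θ₁ N (Φ₁ N) (ballCount x₀ R' ⁻¹' {k}) ≠ 0 :=
  -- CLOSED (lead c5 wave 1, p140050): the landed tree theorem, statement byte-identical.
  Summit.AtomisticToContinuum.HydrodynamicLimit.Theorems.LightConeInLawCSR.stub_chargedAtoms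

/-- STUB 1 — **COUNT WINDOWS** (the planner's former registered STUB 1, now PURE LOGIC from STUBS 1a + 1b — taken as
hypotheses `h1a`, `h1b`; lead c5 reshape; the composition `LightConeInLaw_of` calls this lemma). For the two gases of the crux at time `0` and a ball `B' = B(x₀, R')`, `0 < R' < R`, that
misses a point of the torus: (a) both ball counts, normalised by `N + 1`, converge in probability to ONE
number `m` (`stub_countCentre`, `m = ∫_{B'} ρ₁`); (b) every count atom with `|k/(N+1) − m| ≤ δ₀` is
charged by gas 1 for all large `N` (`stub_chargedAtoms`, fed the unit mass `∫ ρ₁ = 1` that the gas-1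
`LLNAt` hypothesis forces, `integral_eq_one_of_llnAt`). -/
theorem stub_countWindows_of (h1a : type_of% stub_countCentre) (h1b : type_of% stub_chargedAtoms) :
    ∃ η₀ : ℝ, 0 < η₀ ∧
    ∀ (a₁ θ₁ a₂ θ₂ : T3 → ℝ) (u₁ u₂ : T3 → V3), Continuous a₁ → Continuous θ₁ → Continuous u₁ →
      Continuous a₂ → Continuous θ₂ → Continuous u₂ → (∀ x, 0 < a₁ x) → (∀ x, 0 < θ₁ x) →
      (∀ x, 0 < a₂ x) → (∀ x, 0 < θ₂ x) →
    ∀ (σ₁ σ₂ : ℝ), 0 < σ₁ → 0 < σ₂ →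
    ∀ n₂ : ℕ → ℕ, Tendsto (fun N => (n₂ N : ℝ) * hsDiameter σ₁ N ^ 3) atTop (𝓝 (σ₂ ^ 3)) →
    ∀ (Φ₁ : (N : ℕ) → HardSphereFlow G3 (hsDiameter σ₁ N) (N + 1))
      (Φ₂ : (N : ℕ) → HardSphereFlow G3 (hsDiameter σ₁ N) (n₂ N)),
    (∀ N, IsProbabilityMeasure (localGibbsLaw σ₁ a₁ u₁ θ₁ N (Φ₁ N))) →
    (∀ N, IsProbabilityMeasure (particleLaw (Φ₂ N)
      (canonicalDensity G3 (hsDiameter σ₁ N) (n₂ N) (localGibbsProfile a₂ u₂ θ₂)))) →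
    ∀ (ρ₁ Θ₁ ρ₂ Θ₂ : T3 → ℝ) (U₁ U₂ : T3 → V3), Continuous ρ₁ → Continuous ρ₂ →
      (∀ x, 0 < ρ₁ x) →
    LLNAt (fun N => N + 1) (fun N => localGibbsLaw σ₁ a₁ u₁ θ₁ N (Φ₁ N)) Φ₁ ρ₁ U₁ Θ₁ 0 →
    LLNAt n₂ (fun N => particleLaw (Φ₂ N)
      (canonicalDensity G3 (hsDiameter σ₁ N) (n₂ N) (localGibbsProfile a₂ u₂ θ₂))) Φ₂
      ρ₂ U₂ Θ₂ 0 →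
    ∀ (x₀ : T3) (R R' : ℝ), 0 < R' → R' < R → (∃ y, R' < Torus.euclidDist y x₀) →
      (∀ x, Torus.euclidDist x x₀ < R → ρ₁ x * σ₁ ^ 3 = ρ₂ x * σ₂ ^ 3) →
      (∀ x, ρ₁ x * σ₁ ^ 3 < η₀) →
    ∃ m : ℝ,
      CountLLN (fun N => N + 1) (fun N => localGibbsLaw σ₁ a₁ u₁ θ₁ N (Φ₁ N)) x₀ R' m ∧
      CountLLN n₂ (fun N => particleLaw (Φ₂ N)
        (canonicalDensity G3 (hsDiameter σ₁ N) (n₂ N) (localGibbsProfile a₂ u₂ θ₂))) x₀ R' m ∧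
      ∃ δ₀ : ℝ, 0 < δ₀ ∧ ∀ᶠ (N : ℕ) in atTop, ∀ k : ℕ, |(k : ℝ) / ((N : ℝ) + 1) - m| ≤ δ₀ →
        localGibbsLaw σ₁ a₁ u₁ θ₁ N (Φ₁ N) (ballCount x₀ R' ⁻¹' {k}) ≠ 0 := by
  obtain ⟨η₀, hη₀, H⟩ := h1b
  refine ⟨η₀, hη₀, ?_⟩
  intro a₁ θ₁ a₂ θ₂ u₁ u₂ ha₁ hθ₁ hu₁ _ _ _ ha₁0 hθ₁0 _ _ σ₁ σ₂ hσ₁ hσ₂ n₂ hn₂ Φ₁ Φ₂ hP₁ hP₂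
    ρ₁ Θ₁ ρ₂ Θ₂ U₁ U₂ hρ₁ hρ₂ hρ₁0 hL₁ hL₂ x₀ R R' hR' hR'R hres hagree hguard
  have hC := h1a a₁ θ₁ a₂ θ₂ u₁ u₂ σ₁ σ₂ hσ₁ hσ₂ n₂ hn₂ Φ₁ Φ₂ hP₁ hP₂ ρ₁ Θ₁ ρ₂ Θ₂ U₁ U₂
    hρ₁ hρ₂ hL₁ hL₂ x₀ R R' hR' hR'R hagree
  have hmass : ∫ x, ρ₁ x = 1 :=
    integral_eq_one_of_llnAt (n := fun N => N + 1) hP₁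
      (Filter.Eventually.of_forall fun N => Nat.succ_ne_zero N) hL₁
  obtain ⟨δ₀, hδ₀, hch⟩ := H a₁ θ₁ u₁ ha₁ hθ₁ hu₁ ha₁0 hθ₁0 σ₁ hσ₁ Φ₁ hP₁ ρ₁ hρ₁ hρ₁0 hmass x₀ R' hR'
    hres hguard
  exact ⟨_, hC.1, hC.2, δ₀, hδ₀, hch⟩

/-- STUB 2 — **ACTIVITY GAUGE** (statics: profile identification for the activity; size L). If the
time-`0` empirical fields of the two canonical gases of the crux (same diameters `hsDiameter σ₁ N`,
`N + 1` resp. `n₂ N` spheres, one-body profiles `(a₁, u₁, θ₁)`, `(a₂, u₂, θ₂)`) satisfy laws of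
large numbers towards continuous data whose REDUCED densities agree on `B(x₀, R)`, then the two
activities are proportional on that ball: `a₁ = λ a₂` on `B(x₀, R)` for a constant `λ > 0` — so
that the canonical INTERIOR kernels of the two gases given (count, exterior) coincide (a constant
factor of the one-body weight is invisible to a canonical kernel; `u₁ = u₂`, `θ₁ = θ₂` on the ball
are the landed `stub_profileIdOne/stub_profileId` + the agreement clause). Mechanism (size M,
PROVABLE NOW from the tree): `NearConstantShortTimeHL.staticLLN_explicit`
(`Theorems/RelayRaceLocalityNearConstantShortTimeHLStaticLLN.lean`; canonical cluster expansion with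
activity inversion, Pulvirenti–Tsagkarogiannis 2012 Thm 2.1) gives, for EVERY admissible family
`(ε N, n N)` with `n N ε_N³ → σ³` — gas 1 with `σ = σ₁`, gas 2 with `σ = σ₂` — the `t = 0` LLN towards
a continuous positive `ρaᵢ` with `aᵢ = e^{cᵢ} ρaᵢ exp(G(ρaᵢ σᵢ³))`,
`G(φ) = f_ex(φ) + φ f_ex'(φ)` (`hsExcessFreeEnergy`); limits in probability are unique
(probability measures), so the hypothesised `ρᵢ = ρaᵢ`; on the ball `ρ₁σ₁³ = ρ₂σ₂³ =: φ`, hence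
`a₁/a₂ = e^{c₁−c₂} (ρ₁/ρ₂) = e^{c₁−c₂} (σ₂/σ₁)³`, a constant. Why it might fail: it does not (modulo
the bookkeeping of `σ₀ := min` of the two families' thresholds and `n₂ N → ∞`); kept as a stub
because it is a genuine `M`-sized lemma, not glue. -/
theorem stub_activityGauge :
    ∀ (a₁ θ₁ a₂ θ₂ : T3 → ℝ) (u₁ u₂ : T3 → V3), Continuous a₁ → Continuous θ₁ → Continuous u₁ →
      Continuous a₂ → Continuous θ₂ → Continuous u₂ → (∀ x, 0 < a₁ x) → (∀ x, 0 < θ₁ x) →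
      (∀ x, 0 < a₂ x) → (∀ x, 0 < θ₂ x) →
    ∃ σ₀ : ℝ, 0 < σ₀ ∧ ∀ (σ₁ σ₂ : ℝ), 0 < σ₁ → σ₁ < σ₀ → 0 < σ₂ → σ₂ < σ₀ →
    ∀ n₂ : ℕ → ℕ, Tendsto (fun N => (n₂ N : ℝ) * hsDiameter σ₁ N ^ 3) atTop (𝓝 (σ₂ ^ 3)) →
    ∀ (Φ₁ : (N : ℕ) → HardSphereFlow G3 (hsDiameter σ₁ N) (N + 1))
      (Φ₂ : (N : ℕ) → HardSphereFlow G3 (hsDiameter σ₁ N) (n₂ N)),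
    (∀ N, IsProbabilityMeasure (localGibbsLaw σ₁ a₁ u₁ θ₁ N (Φ₁ N))) →
    (∀ N, IsProbabilityMeasure (particleLaw (Φ₂ N)
      (canonicalDensity G3 (hsDiameter σ₁ N) (n₂ N) (localGibbsProfile a₂ u₂ θ₂)))) →
    ∀ (ρ₁ Θ₁ ρ₂ Θ₂ : T3 → ℝ) (U₁ U₂ : T3 → V3), Continuous ρ₁ → Continuous ρ₂ →
    LLNAt (fun N => N + 1) (fun N => localGibbsLaw σ₁ a₁ u₁ θ₁ N (Φ₁ N)) Φ₁ ρ₁ U₁ Θ₁ 0 →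
    LLNAt n₂ (fun N => particleLaw (Φ₂ N)
      (canonicalDensity G3 (hsDiameter σ₁ N) (n₂ N) (localGibbsProfile a₂ u₂ θ₂))) Φ₂
      ρ₂ U₂ Θ₂ 0 →
    ∀ (x₀ : T3) (R : ℝ),
      (∀ x, Torus.euclidDist x x₀ < R → ρ₁ x * σ₁ ^ 3 = ρ₂ x * σ₂ ^ 3) →
    ∃ lam : ℝ, 0 < lam ∧ ∀ x, Torus.euclidDist x x₀ < R → a₁ x = lam * a₂ x :=
  -- CLOSED (lead c5 wave 1, p138234): the landed tree theorem, statement byte-identical.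
  Summit.AtomisticToContinuum.HydrodynamicLimit.Theorems.LightConeInLawCSR.stub_activityGauge

/-- STUB 3 — **EXTERIOR SCREENING at equal ball counts** (the load-bearing stub; size XL). The two
gases of the crux, with their time-`0` velocity/temperature data identified with the local Gibbs
profiles and their activities gauge-equivalent on `B(x₀, R)` (STUB 2), are CONDITIONED on the same
ball count `k` of `B' = B(x₀, R')` (`0 < R' < R`, the ball misses a point; `k` within `δ(N+1)` of the
common LLN centre `m(N+1)`, both atoms charged): then the conditional expectations of the crux
observable tested inside `B(x₀, R' − c t)` differ by at most `β` for all large `N`, for `δ = δ(β)`.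
Content (card count-sufficiency-reduction, S1 + S3a): (i) CANONICAL DLR SUFFICIENCY — given the
count `k` AND the exterior configuration `ω`, the interior law of either gas is the same canonical
`k`-particle hard-core kernel `π_{k,ω} ∝ 𝟙_D(z_in ∪ ω) ∏ a(xᵢ) M_{u(xᵢ),θ(xᵢ)}(vᵢ)` (product
one-body weights × hard core; Fubini over `canonicalDensity`; the constant `λ` cancels); (ii) TWO-RUN
EXTERIOR SCREENING — for one interior sample and two exteriors the reduced fields inside
`B(x₀, R' − c t)` at time `t` agree unless an ALTERNATING two-run collision chain (a sphere is
infected when touched by an infected sphere of EITHER run: prevented collisions are influence)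
crosses the buffer of width `c t` within time `t`; seeds = exterior ∪ a boundary layer of width
`w_N → 0`, `w_N ≫ N^{-1/3}` (static layer coupling of `π_{k,ω}`, `π_{k,ω'}` absorbing the collar's
excluded-volume count fluctuations); relay-race span bound = the route's M1 (Palm link bounds) + M2
(per-link bounds along the TRUE non-equilibrium law), stated DIRECTLY for the conditioned laws
(conditioning costs `e^{NJ(δ)}`, more than the engine's `e^{-cδσ²N^{1/3}}` tail can pay);
(iii) collar statics — the conditional exterior laws of the two gases near `∂B'` merge (profiles
agree on `B(x₀,R) ⊃ ∂B'`; equivalence of ensembles). Honours Disproof §5: false for the ideal gas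
(free streaming crosses any buffer) — any proof uses collisions; §2: thermal/velocity agreement,
support clause and both ties are consumed. Why it might fail: (ii) is the Lieb–Robinson bound for
deterministic hard spheres OUT OF EQUILIBRIUM over macroscopic times (mesoscale channel/crowding
regularity of the true law, unproved; above the route's equilibrium rung `GibbsLightCone`). -/
theorem stub_exteriorScreening :
    ∃ η₀ : ℝ, 0 < η₀ ∧ ∀ M : ℝ, 0 < M → ∃ c : ℝ, 0 < c ∧
    ∀ (a₁ θ₁ a₂ θ₂ : T3 → ℝ) (u₁ u₂ : T3 → V3), Continuous a₁ → Continuous θ₁ → Continuous u₁ →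
      Continuous a₂ → Continuous θ₂ → Continuous u₂ → (∀ x, 0 < a₁ x) → (∀ x, 0 < θ₁ x) →
      (∀ x, 0 < a₂ x) → (∀ x, 0 < θ₂ x) →
    ∃ σ₀ : ℝ, 0 < σ₀ ∧ ∀ (σ₁ σ₂ : ℝ), 0 < σ₁ → σ₁ < σ₀ → 0 < σ₂ → σ₂ < σ₀ →
    ∀ n₂ : ℕ → ℕ, Tendsto (fun N => (n₂ N : ℝ) * hsDiameter σ₁ N ^ 3) atTop (𝓝 (σ₂ ^ 3)) →
    ∀ (T₁ T₂ : ℝ) (ρ₁ Θ₁ ρ₂ Θ₂ : ℝ → T3 → ℝ) (U₁ U₂ : ℝ → T3 → V3),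
      IsHardSphereEulerSolution σ₁ T₁ ρ₁ U₁ Θ₁ → IsHardSphereEulerSolution σ₂ T₂ ρ₂ U₂ Θ₂ →
    ∀ (Φ₁ : (N : ℕ) → HardSphereFlow G3 (hsDiameter σ₁ N) (N + 1))
      (Φ₂ : (N : ℕ) → HardSphereFlow G3 (hsDiameter σ₁ N) (n₂ N)),
    (∀ N, IsProbabilityMeasure (localGibbsLaw σ₁ a₁ u₁ θ₁ N (Φ₁ N))) →
    (∀ N, IsProbabilityMeasure (particleLaw (Φ₂ N)
      (canonicalDensity G3 (hsDiameter σ₁ N) (n₂ N) (localGibbsProfile a₂ u₂ θ₂)))) →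
    TendstoHydroFieldsAt (fun N => localGibbsLaw σ₁ a₁ u₁ θ₁ N (Φ₁ N)) Φ₁ ρ₁ U₁ Θ₁ 0 →
    LLNAt n₂ (fun N => particleLaw (Φ₂ N)
      (canonicalDensity G3 (hsDiameter σ₁ N) (n₂ N) (localGibbsProfile a₂ u₂ θ₂))) Φ₂
      (ρ₂ 0) (U₂ 0) (Θ₂ 0) 0 →
    (∀ x, U₁ 0 x = u₁ x ∧ Θ₁ 0 x = θ₁ x) → (∀ x, U₂ 0 x = u₂ x ∧ Θ₂ 0 x = θ₂ x) →
    ∀ t : ℝ, 0 < t → t < T₁ → t < T₂ →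
      (∀ s ∈ Set.Icc 0 t, ∀ x, ρ₁ s x * σ₁ ^ 3 < η₀ ∧ Θ₁ s x ≤ M ∧ ‖U₁ s x‖ ≤ M ∧
        ρ₂ s x * σ₂ ^ 3 < η₀ ∧ Θ₂ s x ≤ M ∧ ‖U₂ s x‖ ≤ M) →
    ∀ (x₀ : T3) (R R' : ℝ), 0 < R' → R' < R → (∃ y, R' < Torus.euclidDist y x₀) →
      (∀ x, Torus.euclidDist x x₀ < R →
        ρ₁ 0 x * σ₁ ^ 3 = ρ₂ 0 x * σ₂ ^ 3 ∧ U₁ 0 x = U₂ 0 x ∧ Θ₁ 0 x = Θ₂ 0 x) →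
      (∃ lam : ℝ, 0 < lam ∧ ∀ x, Torus.euclidDist x x₀ < R → a₁ x = lam * a₂ x) →
    ∀ m : ℝ, CountLLN (fun N => N + 1) (fun N => localGibbsLaw σ₁ a₁ u₁ θ₁ N (Φ₁ N)) x₀ R' m →
      CountLLN n₂ (fun N => particleLaw (Φ₂ N)
        (canonicalDensity G3 (hsDiameter σ₁ N) (n₂ N) (localGibbsProfile a₂ u₂ θ₂))) x₀ R' m →
    ∀ χ : T3 → ℝ, Continuous χ → (∀ x, R' - c * t ≤ Torus.euclidDist x x₀ → χ x = 0) →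
    ∀ F : ℝ × V3 × ℝ → ℝ, LipschitzWith 1 F → (∀ p, |F p| ≤ 1) →
    ∀ β : ℝ, 0 < β → ∃ δ : ℝ, 0 < δ ∧ ∀ᶠ (N : ℕ) in atTop, ∀ k : ℕ,
      |(k : ℝ) / ((N : ℝ) + 1) - m| ≤ δ →
      localGibbsLaw σ₁ a₁ u₁ θ₁ N (Φ₁ N) (ballCount x₀ R' ⁻¹' {k}) ≠ 0 →
      particleLaw (Φ₂ N) (canonicalDensity G3 (hsDiameter σ₁ N) (n₂ N)
        (localGibbsProfile a₂ u₂ θ₂)) (ballCount x₀ R' ⁻¹' {k}) ≠ 0 →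
      |∫ z, obsF (Φ₁ N) σ₁ t χ F z
          ∂((localGibbsLaw σ₁ a₁ u₁ θ₁ N (Φ₁ N))[|ballCount x₀ R' ⁻¹' {k}]) -
        ∫ z, obsF (Φ₂ N) σ₂ t χ F z
          ∂((particleLaw (Φ₂ N) (canonicalDensity G3 (hsDiameter σ₁ N) (n₂ N)
            (localGibbsProfile a₂ u₂ θ₂)))[|ballCount x₀ R' ⁻¹' {k}])| ≤ β := by
  sorry

/-- STUB 4 — **COUNT-CONDITIONAL INSENSITIVITY** (CCI; one gas, no cone, no comparison gas;
size XL). For the conjunct's gas (local Gibbs profile `(a, u, θ)`, `N + 1` spheres, LLN at `0`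
towards a classical solution obeying the guards on `[0, t]`) and a ball `B(x₀, r)` whose count
satisfies a law of large numbers with centre `m`: for every `γ > 0` there is `δ > 0` such that, for
all large `N`, conditioning on two charged count atoms `k, k'` within `δ (N+1)` of `m (N+1)` changes
the expectation of the crux observable at time `t` by at most `γ` — continuity AT `m` of the map
(ball mass ↦ conditioned time-`t` law), uniformly in `N` (equivalent to the `o(N)`-window form
"`osc_{|k−m(N+1)| ≤ w_N} → 0` for every `w_N = o(N)`" by a diagonal argument). It is the card's
residual (S2): law-level stability of the macroscopic dynamics in ONE scalar direction (mass of a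
ball) in MEAN — of weak–strong-stability type at the classical solution; its GLOBAL form is STUB 5,
which the crux provably implies. Suppliers on the board: the canonical ball-count tilt +
Feynman–Hellmann identity + CLT-rate variance (cards susceptibility-variance-continuity /
demix-not-couple: offsets `≫ √N`), contiguity + rate-free concentration (offsets `≲ √N`), the
exact deletion identity (card exchangeable-deletion-ghost, statics); free at global equilibrium
(flow-invariance + static large deviations: the line's first provable rung). Why it might fail: it
is a hydrodynamic-limit-type statement (no rate, one direction, in mean) about deterministic hard
spheres out of equilibrium; the conditioned data carry a density step of size `δ` at `∂B`, so the
needed stability is of weak–strong type at the smooth solution — unproved for any deterministic gas. -/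
theorem stub_countInsensitivity :
    ∃ η₀ : ℝ, 0 < η₀ ∧ ∀ M : ℝ, 0 < M →
    ∀ (a θ : T3 → ℝ) (u : T3 → V3), Continuous a → Continuous θ → Continuous u →
      (∀ x, 0 < a x) → (∀ x, 0 < θ x) →
    ∃ σ₀ : ℝ, 0 < σ₀ ∧ ∀ σ : ℝ, 0 < σ → σ < σ₀ →
    ∀ (T : ℝ) (ρ Θ : ℝ → T3 → ℝ) (U : ℝ → T3 → V3), IsHardSphereEulerSolution σ T ρ U Θ →
    ∀ Φ : (N : ℕ) → HardSphereFlow G3 (hsDiameter σ N) (N + 1),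
    (∀ N, IsProbabilityMeasure (localGibbsLaw σ a u θ N (Φ N))) →
    TendstoHydroFieldsAt (fun N => localGibbsLaw σ a u θ N (Φ N)) Φ ρ U Θ 0 →
    ∀ t : ℝ, 0 ≤ t → t < T →
      (∀ s ∈ Set.Icc 0 t, ∀ x, ρ s x * σ ^ 3 < η₀ ∧ Θ s x ≤ M ∧ ‖U s x‖ ≤ M) →
    ∀ (x₀ : T3) (r m : ℝ),
      CountLLN (fun N => N + 1) (fun N => localGibbsLaw σ a u θ N (Φ N)) x₀ r m →
    ∀ χ : T3 → ℝ, Continuous χ → ∀ F : ℝ × V3 × ℝ → ℝ, LipschitzWith 1 F → (∀ p, |F p| ≤ 1) →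
    ∀ γ : ℝ, 0 < γ → ∃ δ : ℝ, 0 < δ ∧ ∀ᶠ (N : ℕ) in atTop, ∀ k k' : ℕ,
      |(k : ℝ) / ((N : ℝ) + 1) - m| ≤ δ → |(k' : ℝ) / ((N : ℝ) + 1) - m| ≤ δ →
      localGibbsLaw σ a u θ N (Φ N) (ballCount x₀ r ⁻¹' {k}) ≠ 0 →
      localGibbsLaw σ a u θ N (Φ N) (ballCount x₀ r ⁻¹' {k'}) ≠ 0 →
      |∫ z, obsF (Φ N) σ t χ F z ∂((localGibbsLaw σ a u θ N (Φ N))[|ballCount x₀ r ⁻¹' {k}]) -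
        ∫ z, obsF (Φ N) σ t χ F z ∂((localGibbsLaw σ a u θ N (Φ N))[|ballCount x₀ r ⁻¹' {k'}])|
        ≤ γ := by
  sorry

/-- STUB 5 — **PARTICLE-NUMBER CONTINUITY** (PNC, the global form of STUB 4; size XL; NECESSARY:
the tree's `Necessary.particleNumberContinuity_of_lightConeInLaw` proves `LightConeInLaw → this`,
and the statement below is its conclusion VERBATIM). For the conjunct's gas (`N + 1` spheres) and a
comparison gas of the SAME profile and diameter with `n₂ N` spheres, `n₂ N ε_N³ → σ³`
(i.e. `n₂ N = (N+1)(1+o(1))`), both with laws of large numbers at `0` towards the same classical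
solution: the laws of the reduced fields at time `t` merge, for every continuous `χ` (no cone). Used
by the composition ONLY when the agreement ball covers the torus (then `σ₁ = σ₂`, the profiles are
gauge-equal everywhere and the crux IS this statement); in the local regime the particle-number
slack is absorbed by the exterior reservoir through STUBS 3–4. Why it might fail: law-level
stability of the macroscopic dynamics under `o(N)` added spheres is of hydrodynamic-limit type
(refuter 19843/19844); no locality content; it contains a.e.-uniqueness of the hard-sphere flow
(`HardSphereFlow.flow_eq_ae`, Alexander) already for `n₂ N = N + 1`. -/
theorem stub_particleNumberContinuity :
    ∃ η₀ : ℝ, 0 < η₀ ∧ ∀ M : ℝ, 0 < M →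
    ∀ (a θ : T3 → ℝ) (u : T3 → V3), Continuous a → Continuous θ → Continuous u →
      (∀ x, 0 < a x) → (∀ x, 0 < θ x) →
    ∃ σ₀ : ℝ, 0 < σ₀ ∧ ∀ σ : ℝ, 0 < σ → σ < σ₀ →
    ∀ n₂ : ℕ → ℕ, Tendsto (fun N => (n₂ N : ℝ) * hsDiameter σ N ^ 3) atTop (𝓝 (σ ^ 3)) →
    ∀ (T : ℝ) (ρ Θ : ℝ → T3 → ℝ) (U : ℝ → T3 → V3), IsHardSphereEulerSolution σ T ρ U Θ →
    ∀ (Φ₁ : (N : ℕ) → HardSphereFlow G3 (hsDiameter σ N) (N + 1))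
      (Φ₂ : (N : ℕ) → HardSphereFlow G3 (hsDiameter σ N) (n₂ N)),
    (∀ N, IsProbabilityMeasure (localGibbsLaw σ a u θ N (Φ₁ N))) →
    (∀ N, IsProbabilityMeasure (particleLaw (Φ₂ N)
      (canonicalDensity G3 (hsDiameter σ N) (n₂ N) (localGibbsProfile a u θ)))) →
    TendstoHydroFieldsAt (fun N => localGibbsLaw σ a u θ N (Φ₁ N)) Φ₁ ρ U Θ 0 →
    LLNAt n₂ (fun N => particleLaw (Φ₂ N)
      (canonicalDensity G3 (hsDiameter σ N) (n₂ N) (localGibbsProfile a u θ))) Φ₂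
      (ρ 0) (U 0) (Θ 0) 0 →
    ∀ t : ℝ, 0 ≤ t → t < T →
      (∀ s ∈ Set.Icc 0 t, ∀ x, ρ s x * σ ^ 3 < η₀ ∧ Θ s x ≤ M ∧ ‖U s x‖ ≤ M) →
    ∀ χ : T3 → ℝ, Continuous χ →
    ∀ F : ℝ × V3 × ℝ → ℝ, LipschitzWith 1 F → (∀ p, |F p| ≤ 1) →
      Tendsto (fun N =>
        (∫ z, F (σ ^ 3 * empiricalDensityField ((Φ₁ N).flow t z) χ,
            (σ ^ 3) • empiricalMomentumField ((Φ₁ N).flow t z) χ,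
            σ ^ 3 * empiricalEnergyField ((Φ₁ N).flow t z) χ) ∂(localGibbsLaw σ a u θ N (Φ₁ N))) -
        ∫ z, F (σ ^ 3 * empiricalDensityField ((Φ₂ N).flow t z) χ,
            (σ ^ 3) • empiricalMomentumField ((Φ₂ N).flow t z) χ,
            σ ^ 3 * empiricalEnergyField ((Φ₂ N).flow t z) χ) ∂(particleLaw (Φ₂ N)
              (canonicalDensity G3 (hsDiameter σ N) (n₂ N) (localGibbsProfile a u θ))))
        atTop (𝓝 0) := by
  sorry

end Holds

/-! ## Stub statements by name (D-0027 §3.3) -/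

/-- Statement of STUB 1a, by name (registered; lead c5 reshape). -/
def stub_countCentre : Prop := type_of% Holds.stub_countCentre
/-- Statement of STUB 1b, by name (registered; lead c5 reshape). -/
def stub_chargedAtoms : Prop := type_of% Holds.stub_chargedAtoms
/-- Statement of STUB 2, by name. -/
def stub_activityGauge : Prop := type_of% Holds.stub_activityGauge
/-- Statement of STUB 3, by name. -/
def stub_exteriorScreening : Prop := type_of% Holds.stub_exteriorScreening
/-- Statement of STUB 4, by name. -/
def stub_countInsensitivity : Prop := type_of% Holds.stub_countInsensitivity
/-- Statement of STUB 5, by name. -/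
def stub_particleNumberContinuity : Prop := type_of% Holds.stub_particleNumberContinuity

/-- CERTIFICATE: STUB 5 is NECESSARY — the crux implies it (tree theorem, kernel-checked). -/
example : Summit.AtomisticToContinuum.HydrodynamicLimit.Theses.RelayRaceLocality.LightConeInLaw →
    stub_particleNumberContinuity :=
  Necessary.particleNumberContinuity_of_lightConeInLaw

/-! ## Small tools for the composition -/

/-- **Global agreement of reduced densities of unit mass forces equal reduced diameters.**
(From `Disproof.lean` §1, `sigma_eq_of_global_agreement`.) -/
theorem sigma_eq_of_global_agreement {ρ₁ ρ₂ : T3 → ℝ} {σ₁ σ₂ : ℝ} (hσ₁ : 0 < σ₁) (hσ₂ : 0 < σ₂)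
    (h₁ : ∫ x, ρ₁ x = 1) (h₂ : ∫ x, ρ₂ x = 1) (h : ∀ x, ρ₁ x * σ₁ ^ 3 = ρ₂ x * σ₂ ^ 3) :
    σ₁ = σ₂ := by
  have hint : ∫ x, ρ₁ x * σ₁ ^ 3 = ∫ x, ρ₂ x * σ₂ ^ 3 := integral_congr_ae (ae_of_all _ h)
  rw [integral_mul_const, integral_mul_const, h₁, h₂, one_mul, one_mul] at hint
  exact le_antisymm (le_of_pow_le_pow_left₀ three_ne_zero hσ₂.le hint.le)
    (le_of_pow_le_pow_left₀ three_ne_zero hσ₁.le hint.ge)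

/-- The local Gibbs profile is linear in the activity. -/
theorem localGibbsProfile_const_mul (lam : ℝ) (a θ : T3 → ℝ) (u : T3 → V3) :
    localGibbsProfile (fun x => lam * a x) u θ = fun y => lam * localGibbsProfile a u θ y := by
  funext y
  simp only [localGibbsProfile]
  ring

/-! ## Composition (sorry-free): the five stubs ⟹ the crux BY NAME -/

/-- **The skeleton theorem.** `η₀ := min` of the stubs' thresholds, `c := c_screening(M) + 1`,
`σ₀ := min` of the stubs' `σ₀`'s. Given the data of the crux: `t = 0` is the landed
`TimeZero.stub_timeZero`; for `0 < t` and `R − c t ≤ 0` the test function vanishes; for `0 < t`,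
`0 < R − c t` and a ball `B(x₀, R − t/2)` that MISSES a point (local regime) the mixture lemma is fed
by STUB 1 (window `|k/(N+1) − m| ≤ δ`, positivity of gas-1 atoms), STUB 3 (conditional merging at
equal counts, through the profile identifications of the landed `stub_profileIdOne/stub_profileId`
and the gauge of STUB 2) and STUB 4 (oscillation of gas 1's conditional expectations); otherwise the
agreement ball covers the torus, the LLN hypotheses force unit masses hence `σ₁ = σ₂`, the profiles
are gauge-equal everywhere (STUB 2 + identifications), the comparison law IS the conjunct's profile's
canonical law (`canonicalDensity_const_mul`), and STUB 5 concludes. -/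
theorem LightConeInLaw_of (h₃ : stub_exteriorScreening) (h₄ : stub_countInsensitivity)
    (h₅ : stub_particleNumberContinuity) :
    Summit.AtomisticToContinuum.HydrodynamicLimit.Theses.RelayRaceLocality.LightConeInLaw := by
  -- the three statics stubs are CLOSED (lead c5 wave 1): discharged here by the landed tree theorems
  have h₁a : stub_countCentre := Holds.stub_countCentre
  have h₁b : stub_chargedAtoms := Holds.stub_chargedAtoms
  have h₂ : stub_activityGauge := Holds.stub_activityGauge
  have h₁ := Holds.stub_countWindows_of h₁a h₁b
  have H0 := TimeZero.stub_timeZero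
  have HI1 := ProfileIdOne.stub_profileIdOne
  have HI2 := ProfileId.stub_profileId
  obtain ⟨ηw, hηw, Hw⟩ := h₁
  have Hg : type_of% Holds.stub_activityGauge := h₂
  obtain ⟨ηs, hηs, Hs⟩ := (h₃ : type_of% Holds.stub_exteriorScreening)
  obtain ⟨ηc, hηc, Hc⟩ := (h₄ : type_of% Holds.stub_countInsensitivity)
  obtain ⟨ηp, hηp, Hp⟩ := (h₅ : type_of% Holds.stub_particleNumberContinuity)
  set η₀ : ℝ := min (min ηw ηs) (min ηc ηp) with hη₀def
  have hη₀ : 0 < η₀ := lt_min (lt_min hηw hηs) (lt_min hηc hηp)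
  have hη₀w : η₀ ≤ ηw := (min_le_left _ _).trans (min_le_left _ _)
  have hη₀s : η₀ ≤ ηs := (min_le_left _ _).trans (min_le_right _ _)
  have hη₀c : η₀ ≤ ηc := (min_le_right _ _).trans (min_le_left _ _)
  have hη₀p : η₀ ≤ ηp := (min_le_right _ _).trans (min_le_right _ _)
  refine ⟨η₀, hη₀, fun M hM => ?_⟩
  obtain ⟨cs, hcs, Hs'⟩ := Hs M hM
  have Hc' := Hc M hM
  have Hp' := Hp M hM
  refine ⟨cs + 1, by linarith, ?_⟩
  intro a₁ θ₁ a₂ θ₂ u₁ u₂ ha₁ hθ₁ hu₁ ha₂ hθ₂ hu₂ ha₁0 hθ₁0 ha₂0 hθ₂0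
  obtain ⟨σg, hσg, Hg'⟩ := Hg a₁ θ₁ a₂ θ₂ u₁ u₂ ha₁ hθ₁ hu₁ ha₂ hθ₂ hu₂ ha₁0 hθ₁0 ha₂0 hθ₂0
  obtain ⟨σs, hσs, Hs''⟩ := Hs' a₁ θ₁ a₂ θ₂ u₁ u₂ ha₁ hθ₁ hu₁ ha₂ hθ₂ hu₂ ha₁0 hθ₁0 ha₂0 hθ₂0
  obtain ⟨σc, hσc, Hc''⟩ := Hc' a₁ θ₁ u₁ ha₁ hθ₁ hu₁ ha₁0 hθ₁0
  obtain ⟨σp, hσp, Hp''⟩ := Hp' a₁ θ₁ u₁ ha₁ hθ₁ hu₁ ha₁0 hθ₁0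
  have Hw' := Hw a₁ θ₁ a₂ θ₂ u₁ u₂ ha₁ hθ₁ hu₁ ha₂ hθ₂ hu₂ ha₁0 hθ₁0 ha₂0 hθ₂0
  set σ₀ : ℝ := min (min σg σs) (min σc σp) with hσ₀def
  have hσ₀ : 0 < σ₀ := lt_min (lt_min hσg hσs) (lt_min hσc hσp)
  have hσ₀g : σ₀ ≤ σg := (min_le_left _ _).trans (min_le_left _ _)
  have hσ₀s : σ₀ ≤ σs := (min_le_left _ _).trans (min_le_right _ _)
  have hσ₀c : σ₀ ≤ σc := (min_le_right _ _).trans (min_le_left _ _)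
  have hσ₀p : σ₀ ≤ σp := (min_le_right _ _).trans (min_le_right _ _)
  refine ⟨σ₀, hσ₀, ?_⟩
  intro σ₁ σ₂ hσ₁ hσ₁' hσ₂ hσ₂' n₂ hn₂ T₁ T₂ ρ₁ Θ₁ ρ₂ Θ₂ U₁ U₂ hsol₁ hsol₂ Φ₁ Φ₂ P₁ P₂ hP₁ hP₂
    hL₁ hL₂ t ht htT₁ htT₂ hguard x₀ R hagree χ hχ hsupp F hF hFb
  -- unfolded copies of the hypotheses on the two laws
  have hP₁u : ∀ N, IsProbabilityMeasure (localGibbsLaw σ₁ a₁ u₁ θ₁ N (Φ₁ N)) := hP₁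
  have hP₂u : ∀ N, IsProbabilityMeasure (particleLaw (Φ₂ N)
      (canonicalDensity G3 (hsDiameter σ₁ N) (n₂ N) (localGibbsProfile a₂ u₂ θ₂))) := hP₂
  have hL₁u : LLNAt (fun N => N + 1) (fun N => localGibbsLaw σ₁ a₁ u₁ θ₁ N (Φ₁ N)) Φ₁
      (ρ₁ 0) (U₁ 0) (Θ₁ 0) 0 := hL₁
  have hL₂u : LLNAt n₂ (fun N => particleLaw (Φ₂ N)
      (canonicalDensity G3 (hsDiameter σ₁ N) (n₂ N) (localGibbsProfile a₂ u₂ θ₂))) Φ₂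
      (ρ₂ 0) (U₂ 0) (Θ₂ 0) 0 := hL₂
  rcases ht.eq_or_lt with rfl | htpos
  · -- the slice `t = 0` (landed stub of the line `Sketch`)
    have hsupp' : ∀ x, R ≤ Torus.euclidDist x x₀ → χ x = 0 := fun x hx =>
      hsupp x (by simpa using hx)
    exact H0 (fun N => N + 1) n₂ (fun N => hsDiameter σ₁ N) (fun N => hsDiameter σ₁ N) σ₁ σ₂
      hσ₁ hσ₂ Φ₁ Φ₂ P₁ P₂ hP₁ hP₂ (ρ₁ 0) (Θ₁ 0) (ρ₂ 0) (Θ₂ 0) (U₁ 0) (U₂ 0) hL₁ hL₂ x₀ R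
      hagree χ hχ hsupp' F hF hFb
  -- positive time: continuity/positivity of the time-0 Euler data and profile identifications
  have h0T₁ : (0 : ℝ) ∈ Set.Ico 0 T₁ := ⟨le_rfl, ht.trans_lt htT₁⟩
  have h0T₂ : (0 : ℝ) ∈ Set.Ico 0 T₂ := ⟨le_rfl, ht.trans_lt htT₂⟩
  have hρ₁c : Continuous (ρ₁ 0) := (hsol₁.smooth_density.isSmooth_slice h0T₁).continuous
  have hρ₂c : Continuous (ρ₂ 0) := (hsol₂.smooth_density.isSmooth_slice h0T₂).continuous
  have hρ₁pos : ∀ x, 0 < ρ₁ 0 x := hsol₁.density_pos 0 h0T₁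
  have hid₁ : ∀ x, U₁ 0 x = u₁ x ∧ Θ₁ 0 x = θ₁ x :=
    HI1 a₁ θ₁ u₁ ha₁ hθ₁ hu₁ ha₁0 hθ₁0 σ₁ hσ₁ Φ₁ hP₁ (ρ₁ 0) (Θ₁ 0) (U₁ 0) hρ₁c
      (hsol₁.smooth_velocity.isSmooth_slice h0T₁).continuous
      (hsol₁.smooth_temperature.isSmooth_slice h0T₁).continuous hρ₁pos hL₁
  have hid₂ : ∀ x, U₂ 0 x = u₂ x ∧ Θ₂ 0 x = θ₂ x :=
    HI2 a₂ θ₂ u₂ ha₂ hθ₂ hu₂ ha₂0 hθ₂0 n₂ (fun N => hsDiameter σ₁ N)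
      (tendsto_atTop_of_mul_hsDiameter σ₁ σ₂ hσ₁ hσ₂ n₂ hn₂) Φ₂ hP₂ (ρ₂ 0) (Θ₂ 0) (U₂ 0) hρ₂c
      (hsol₂.smooth_velocity.isSmooth_slice h0T₂).continuous
      (hsol₂.smooth_temperature.isSmooth_slice h0T₂).continuous (hsol₂.density_pos 0 h0T₂) hL₂
  have hdens : ∀ x, Torus.euclidDist x x₀ < R → ρ₁ 0 x * σ₁ ^ 3 = ρ₂ 0 x * σ₂ ^ 3 :=
    fun x hx => (hagree x hx).1
  -- the activity gauge (STUB 2)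
  obtain ⟨lam, hlam, hgauge⟩ := Hg' σ₁ σ₂ hσ₁ (hσ₁'.trans_le hσ₀g) hσ₂ (hσ₂'.trans_le hσ₀g) n₂
    hn₂ Φ₁ Φ₂ hP₁u hP₂u (ρ₁ 0) (Θ₁ 0) (ρ₂ 0) (Θ₂ 0) (U₁ 0) (U₂ 0) hρ₁c hρ₂c hL₁u hL₂u x₀ R hdens
  by_cases hR : 0 < R - (cs + 1) * t
  swap
  · -- `R - c t ≤ 0`: the test function vanishes identically
    have hzero : ∀ x, χ x = 0 := fun x =>
      hsupp x ((not_lt.mp hR).trans (norm_nonneg _))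
    have hχ0 : χ = fun _ => 0 := funext hzero
    subst hχ0
    have hconst : (fun N =>
        (∫ z, F (σ₁ ^ 3 * empiricalDensityField ((Φ₁ N).flow t z) (fun _ => 0),
            (σ₁ ^ 3) • empiricalMomentumField ((Φ₁ N).flow t z) (fun _ => 0),
            σ₁ ^ 3 * empiricalEnergyField ((Φ₁ N).flow t z) (fun _ => 0)) ∂(P₁ N)) -
        ∫ z, F (σ₂ ^ 3 * empiricalDensityField ((Φ₂ N).flow t z) (fun _ => 0),
            (σ₂ ^ 3) • empiricalMomentumField ((Φ₂ N).flow t z) (fun _ => 0),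
            σ₂ ^ 3 * empiricalEnergyField ((Φ₂ N).flow t z) (fun _ => 0)) ∂(P₂ N)) =
        fun _ => 0 := by
      funext N
      haveI := hP₁ N
      haveI := hP₂ N
      simp [empiricalDensityField, empiricalMomentumField, empiricalEnergyField]
    rw [hconst]
    exact tendsto_const_nhds
  by_cases hloc : ∃ y, R - t / 2 < Torus.euclidDist y x₀
  · /- LOCAL REGIME: the ball `B(x₀, R − t/2)` misses a point; mixture lemma fed by STUBS 1, 3, 4. -/
    set R' : ℝ := R - t / 2 with hR'def
    have hR'pos : 0 < R' := by
      have : (cs + 1) * t = cs * t + t := by ring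
      nlinarith
    have hR'lt : R' < R := by rw [hR'def]; linarith
    have hsuppS : ∀ x, R' - cs * t ≤ Torus.euclidDist x x₀ → χ x = 0 := by
      intro x hx
      refine hsupp x ?_
      have : (cs + 1) * t = cs * t + t := by ring
      rw [hR'def] at hx
      linarith
    have hpack : ∀ x, ρ₁ 0 x * σ₁ ^ 3 < ηw := fun x =>
      lt_of_lt_of_le (hguard 0 ⟨le_rfl, ht⟩ x).1 hη₀w
    -- STUB 1: common window centre `m`, count LLNs, positivity of gas-1 atoms
    obtain ⟨m, hCL₁, hCL₂, δ₀, hδ₀, hposN⟩ := Hw' σ₁ σ₂ hσ₁ hσ₂ n₂ hn₂ Φ₁ Φ₂ hP₁u hP₂u (ρ₁ 0)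
      (Θ₁ 0) (ρ₂ 0) (Θ₂ 0) (U₁ 0) (U₂ 0) hρ₁c hρ₂c hρ₁pos hL₁u hL₂u x₀ R R' hR'pos hR'lt hloc
      hdens hpack
    -- STUB 3: conditional merging at equal counts
    have hguardS : ∀ s ∈ Set.Icc 0 t, ∀ x, ρ₁ s x * σ₁ ^ 3 < ηs ∧ Θ₁ s x ≤ M ∧ ‖U₁ s x‖ ≤ M ∧
        ρ₂ s x * σ₂ ^ 3 < ηs ∧ Θ₂ s x ≤ M ∧ ‖U₂ s x‖ ≤ M := fun s hs x =>
      ⟨lt_of_lt_of_le (hguard s hs x).1 hη₀s, (hguard s hs x).2.1, (hguard s hs x).2.2.1,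
        lt_of_lt_of_le (hguard s hs x).2.2.2.1 hη₀s, (hguard s hs x).2.2.2.2.1,
        (hguard s hs x).2.2.2.2.2⟩
    have HS := Hs'' σ₁ σ₂ hσ₁ (hσ₁'.trans_le hσ₀s) hσ₂ (hσ₂'.trans_le hσ₀s) n₂ hn₂ T₁ T₂ ρ₁ Θ₁
      ρ₂ Θ₂ U₁ U₂ hsol₁ hsol₂ Φ₁ Φ₂ hP₁u hP₂u hL₁ hL₂u hid₁ hid₂ t htpos htT₁ htT₂ hguardS x₀ R R'
      hR'pos hR'lt hloc hagree ⟨lam, hlam, hgauge⟩ m hCL₁ hCL₂ χ hχ hsuppS F hF hFb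
    -- STUB 4: oscillation of gas 1's conditional expectations
    have hguardC : ∀ s ∈ Set.Icc 0 t, ∀ x, ρ₁ s x * σ₁ ^ 3 < ηc ∧ Θ₁ s x ≤ M ∧ ‖U₁ s x‖ ≤ M :=
      fun s hs x => ⟨lt_of_lt_of_le (hguard s hs x).1 hη₀c, (hguard s hs x).2.1,
        (hguard s hs x).2.2.1⟩
    have HC := Hc'' σ₁ hσ₁ (hσ₁'.trans_le hσ₀c) T₁ ρ₁ Θ₁ U₁ hsol₁ Φ₁ hP₁u hL₁ t ht htT₁ hguardC
      x₀ R' m hCL₁ χ hχ F hF hFb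
    -- the `ε`-argument
    rw [Metric.tendsto_nhds]
    intro ε hε
    have hε8 : 0 < ε / 8 := by positivity
    obtain ⟨δs, hδs, hSev⟩ := HS (ε / 8) hε8
    obtain ⟨δc, hδc, hCev⟩ := HC (ε / 8) hε8
    set δ : ℝ := min (min δs δc) δ₀ with hδdef
    have hδ : 0 < δ := lt_min (lt_min hδs hδc) hδ₀
    have hδs' : δ ≤ δs := (min_le_left _ _).trans (min_le_left _ _)
    have hδc' : δ ≤ δc := (min_le_left _ _).trans (min_le_right _ _)
    have hδ₀' : δ ≤ δ₀ := min_le_right _ _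
    have hW₁ev := ENNReal.tendsto_nhds_zero.1 (hCL₁ δ hδ) (ENNReal.ofReal (ε / 8))
      (ENNReal.ofReal_pos.2 hε8)
    have hW₂ev := ENNReal.tendsto_nhds_zero.1 (hCL₂ δ hδ) (ENNReal.ofReal (ε / 8))
      (ENNReal.ofReal_pos.2 hε8)
    filter_upwards [hSev, hCev, hposN, hW₁ev, hW₂ev] with N hSN hCN hpN hW₁N hW₂N
    rw [Real.dist_eq, sub_zero]
    -- the window of counts at level `N`
    set W : Finset ℕ := (Finset.range (N + 1 + n₂ N + 1)).filter
      (fun k => |(k : ℝ) / ((N : ℝ) + 1) - m| ≤ δ) with hWdef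
    have hmemW : ∀ {k : ℕ}, k ∈ W → |(k : ℝ) / ((N : ℝ) + 1) - m| ≤ δ := fun hk =>
      (Finset.mem_filter.1 hk).2
    haveI := hP₁ N
    haveI := hP₂ N
    -- (W) both counts lie in the window up to probability `ε/8`
    have hout₁ : {z : Config (N + 1) (Fin 3) T3 | ballCount x₀ R' z ∉ W} ⊆
        {z | δ < |(ballCount x₀ R' z : ℝ) / ((N : ℝ) + 1) - m|} := by
      intro z hz
      simp only [Set.mem_setOf_eq] at hz ⊢
      by_contra hle
      refine hz (Finset.mem_filter.2 ⟨Finset.mem_range.2 ?_, not_lt.1 hle⟩)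
      have := ballCount_le x₀ R' z
      omega
    have hout₂ : {z : Config (n₂ N) (Fin 3) T3 | ballCount x₀ R' z ∉ W} ⊆
        {z | δ < |(ballCount x₀ R' z : ℝ) / ((N : ℝ) + 1) - m|} := by
      intro z hz
      simp only [Set.mem_setOf_eq] at hz ⊢
      by_contra hle
      refine hz (Finset.mem_filter.2 ⟨Finset.mem_range.2 ?_, not_lt.1 hle⟩)
      have := ballCount_le x₀ R' z
      omega
    have hWr₁ : (localGibbsLaw σ₁ a₁ u₁ θ₁ N (Φ₁ N)).real
        {z | ballCount x₀ R' z ∉ W} ≤ ε / 8 :=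
      (measureReal_mono hout₁).trans (ENNReal.toReal_le_of_le_ofReal hε8.le hW₁N)
    have hWr₂ : (particleLaw (Φ₂ N) (canonicalDensity G3 (hsDiameter σ₁ N) (n₂ N)
        (localGibbsProfile a₂ u₂ θ₂))).real {z | ballCount x₀ R' z ∉ W} ≤ ε / 8 :=
      (measureReal_mono hout₂).trans (ENNReal.toReal_le_of_le_ofReal hε8.le hW₂N)
    -- (P) positivity of gas-1 atoms of the window
    have hposW : ∀ k ∈ W, localGibbsLaw σ₁ a₁ u₁ θ₁ N (Φ₁ N) (ballCount x₀ R' ⁻¹' {k}) ≠ 0 :=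
      fun k hk => hpN k ((hmemW hk).trans hδ₀')
    -- (S) conditional merging at equal counts, (C) oscillation over the window
    have hSW : ∀ k ∈ W, particleLaw (Φ₂ N) (canonicalDensity G3 (hsDiameter σ₁ N) (n₂ N)
        (localGibbsProfile a₂ u₂ θ₂)) (ballCount x₀ R' ⁻¹' {k}) ≠ 0 →
        |∫ z, obsF (Φ₁ N) σ₁ t χ F z
            ∂((localGibbsLaw σ₁ a₁ u₁ θ₁ N (Φ₁ N))[|ballCount x₀ R' ⁻¹' {k}]) -
          ∫ z, obsF (Φ₂ N) σ₂ t χ F z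
            ∂((particleLaw (Φ₂ N) (canonicalDensity G3 (hsDiameter σ₁ N) (n₂ N)
              (localGibbsProfile a₂ u₂ θ₂)))[|ballCount x₀ R' ⁻¹' {k}])| ≤ ε / 8 :=
      fun k hk h₂ => hSN k ((hmemW hk).trans hδs') (hposW k hk) h₂
    have hCW : ∀ k ∈ W, ∀ k' ∈ W,
        |∫ z, obsF (Φ₁ N) σ₁ t χ F z
            ∂((localGibbsLaw σ₁ a₁ u₁ θ₁ N (Φ₁ N))[|ballCount x₀ R' ⁻¹' {k}]) -
          ∫ z, obsF (Φ₁ N) σ₁ t χ F z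
            ∂((localGibbsLaw σ₁ a₁ u₁ θ₁ N (Φ₁ N))[|ballCount x₀ R' ⁻¹' {k'}])| ≤ ε / 8 :=
      fun k hk k' hk' => hCN k k' ((hmemW hk).trans hδc') ((hmemW hk').trans hδc')
        (hposW k hk) (hposW k' hk')
    have hmix := mixture_bound (localGibbsLaw σ₁ a₁ u₁ θ₁ N (Φ₁ N))
      (particleLaw (Φ₂ N) (canonicalDensity G3 (hsDiameter σ₁ N) (n₂ N)
        (localGibbsProfile a₂ u₂ θ₂)))
      (measurable_ballCount x₀ R') (measurable_ballCount x₀ R')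
      (measurable_obsF (Φ₁ N) σ₁ t hχ hF) (measurable_obsF (Φ₂ N) σ₂ t hχ hF)
      (fun z => hFb _) (fun z => hFb _) W hε8.le hε8.le hε8.le hWr₁ hWr₂ hposW hSW hCW
    refine lt_of_le_of_lt hmix ?_
    linarith
  · /- GLOBAL REGIME: the agreement ball covers the torus; the crux is particle-number
       continuity (STUB 5) after `σ₁ = σ₂` and the gauge identification of the profiles. -/
    push Not at hloc
    have hall : ∀ y, Torus.euclidDist y x₀ < R := fun y => (hloc y).trans_lt (by linarith)
    have hagree' : ∀ x, ρ₁ 0 x * σ₁ ^ 3 = ρ₂ 0 x * σ₂ ^ 3 ∧ U₁ 0 x = U₂ 0 x ∧ Θ₁ 0 x = Θ₂ 0 x :=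
      fun x => hagree x (hall x)
    -- unit masses and `σ₁ = σ₂`
    have hmass₁ : ∫ x, ρ₁ 0 x = 1 :=
      integral_eq_one_of_llnAt (n := fun N => N + 1) hP₁u
        (Filter.Eventually.of_forall fun N => Nat.succ_ne_zero N) hL₁u
    have hn₂top : Tendsto n₂ atTop atTop := tendsto_atTop_of_mul_hsDiameter σ₁ σ₂ hσ₁ hσ₂ n₂ hn₂
    have hmass₂ : ∫ x, ρ₂ 0 x = 1 :=
      integral_eq_one_of_llnAt (n := n₂) hP₂u
        ((hn₂top.eventually_ge_atTop 1).mono fun N hN => Nat.one_le_iff_ne_zero.1 hN) hL₂u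
    have hσeq : σ₁ = σ₂ :=
      sigma_eq_of_global_agreement hσ₁ hσ₂ hmass₁ hmass₂ fun x => (hagree' x).1
    subst hσeq
    -- identification of all profiles on the whole torus
    have hσ3 : (σ₁ ^ 3 : ℝ) ≠ 0 := pow_ne_zero 3 hσ₁.ne'
    have hρeq : ρ₂ 0 = ρ₁ 0 := funext fun x =>
      (mul_right_cancel₀ hσ3 (hagree' x).1).symm
    have hUeq : U₂ 0 = U₁ 0 := funext fun x => ((hagree' x).2.1).symm
    have hΘeq : Θ₂ 0 = Θ₁ 0 := funext fun x => ((hagree' x).2.2).symm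
    have hueq : u₂ = u₁ := funext fun x => by
      rw [← (hid₂ x).1, ← (hid₁ x).1, (hagree' x).2.1]
    have hθeq : θ₂ = θ₁ := funext fun x => by
      rw [← (hid₂ x).2, ← (hid₁ x).2, (hagree' x).2.2]
    have haeq : a₁ = fun x => lam * a₂ x := funext fun x => hgauge x (hall x)
    have hprof : localGibbsProfile a₁ u₁ θ₁ = fun y => lam * localGibbsProfile a₂ u₂ θ₂ y := by
      rw [haeq, hueq, hθeq]
      exact localGibbsProfile_const_mul lam a₂ θ₁ u₁
    have hlaw : ∀ N, particleLaw (Φ₂ N) (canonicalDensity G3 (hsDiameter σ₁ N) (n₂ N)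
        (localGibbsProfile a₂ u₂ θ₂)) = particleLaw (Φ₂ N)
        (canonicalDensity G3 (hsDiameter σ₁ N) (n₂ N) (localGibbsProfile a₁ u₁ θ₁)) := by
      intro N
      rw [hprof, canonicalDensity_const_mul hlam.ne']
    -- transport the hypotheses on gas 2 to the conjunct's profile
    have hP₂' : ∀ N, IsProbabilityMeasure (particleLaw (Φ₂ N)
        (canonicalDensity G3 (hsDiameter σ₁ N) (n₂ N) (localGibbsProfile a₁ u₁ θ₁))) :=
      fun N => hlaw N ▸ hP₂u N
    have hL₂' : LLNAt n₂ (fun N => particleLaw (Φ₂ N)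
        (canonicalDensity G3 (hsDiameter σ₁ N) (n₂ N) (localGibbsProfile a₁ u₁ θ₁))) Φ₂
        (ρ₁ 0) (U₁ 0) (Θ₁ 0) 0 := by
      rw [← hρeq, ← hUeq, ← hΘeq]
      simpa only [hlaw] using hL₂u
    have hguardP : ∀ s ∈ Set.Icc 0 t, ∀ x, ρ₁ s x * σ₁ ^ 3 < ηp ∧ Θ₁ s x ≤ M ∧ ‖U₁ s x‖ ≤ M :=
      fun s hs x => ⟨lt_of_lt_of_le (hguard s hs x).1 hη₀p, (hguard s hs x).2.1,
        (hguard s hs x).2.2.1⟩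
    have key := Hp'' σ₁ hσ₁ (hσ₁'.trans_le hσ₀p) n₂ hn₂ T₁ ρ₁ Θ₁ U₁ hsol₁ Φ₁ Φ₂ hP₁u hP₂' hL₁
      hL₂' t ht htT₁ hguardP χ hχ F hF hFb
    have hP₁def : ∀ N, P₁ N = localGibbsLaw σ₁ a₁ u₁ θ₁ N (Φ₁ N) := fun N => rfl
    have hP₂def : ∀ N, P₂ N = particleLaw (Φ₂ N) (canonicalDensity G3 (hsDiameter σ₁ N) (n₂ N)
        (localGibbsProfile a₂ u₂ θ₂)) := fun N => rfl
    simpa only [hP₁def, hP₂def, hlaw] using key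

/-- D-0027 §3.3 shape: the crux from the registered stubs — an `example`, so that
`LightConeInLaw_of` stays the unique theorem concluding the crux; it becomes the proof of the item
once the three remaining `sorry`s (`Holds.stub_exteriorScreening/_countInsensitivity/_particleNumberContinuity`)
are discharged. -/
example : Summit.AtomisticToContinuum.HydrodynamicLimit.Theses.RelayRaceLocality.LightConeInLaw :=
  LightConeInLaw_of Holds.stub_exteriorScreening Holds.stub_countInsensitivity
    Holds.stub_particleNumberContinuity


end

end Summit.AtomisticToContinuum.HydrodynamicLimit.Cruxes.LightConeInLaw.CountSufficiencyReduction
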